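import Summits.ResolutionOfSingularities.ResolutionOfSingularities.Theses.RisoStrata
import Summits.ResolutionOfSingularities.ResolutionOfSingularities.Theorems.WeightedThesis.Negative.LoadBearing
import Literature.AlgebraicGeometry.Resolution.NonReducedNoResolution
import Literature.AlgebraicGeometry.Resolution.AbsoluteIntegralClosureNoResolution
import Mathlib.FieldTheory.Finite.GaloisField
import Mathlib.FieldTheory.IsAlgClosed.AlgebraicClosure
import Literature.AlgebraicGeometry.Motives.GeometricallyReducedPerfectField

/-!
# Disproof of `DescentAlgclosedToPerfect` (stmt-ResolutionOfSingularities-0550) — findings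

Standing disprover's work file (cdisprove gen 1, cycle 1, 2026-08-17; route
`route-ResolutionOfSingularities-RisoStrata`, rank 4; the item is SHARED `rfl`-equally with routes
Descent r3 / UniformComplexity r4 / EquisingularLift r5 / TropicalLinks r4 / AbhyankarShadows r5 /
TeissierJung r5). Everything below is kernel-checked and sorry-free (§E states the open step as a hypothesis).

The crux `C`: `∀ p prime, Antecedent p → Consequent p`, where
* `Antecedent p` = every reduced separated scheme of finite type over every ALGEBRAICALLY CLOSED
  field of characteristic `p` has a resolution (`Scheme.HasResolution`, an ABSOLUTE property of
  the scheme: proper birational morphism from a regular scheme);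
* `Consequent p` = the same over every PERFECT field of characteristic `p`.

## VERDICT (cycle 1): NO KILL — the crux is irrefutable relative to the summit.
`¬ C ↔ ∃ p prime, Antecedent p ∧ ¬ Consequent p` (`not_crux_iff`): a refutation must PROVE
resolution over all algebraically closed fields of some prime characteristic (open from dimension
4) AND exhibit a reduced finite-type scheme over a perfect field with no resolution (none is in
print); and `¬ C → ¬ ResolutionOfSingularities` (`not_summit_of_not_crux`). Modulo
`CossartPiltant2019` the witness half is an integral closed subscheme of some `ℙⁿ_k`, `dim ≥ 4`,
over a perfect NOT algebraically closed `k` (`not_crux_iff_minimalCase`). No finite / decidable /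
computable instance exists, so no `decide`/`kit compute` attack applies.

## INDEX OF FINDINGS
* §A LOAD-BEARING ANALYSIS (one `def …Without<H>` + theorem per hypothesis):
  - antecedent side: `antecedent_false_without_isReduced` (witness `Spec 𝔽̄_p[ε]`),
    `antecedent_false_without_locallyOfFiniteType` (witness `Spec 𝔽̄_p[X]⁺`, generic-field re-run
    of the tree's absolute-integral-closure argument) ⇒ the crux WITHOUT these antecedent
    hypotheses holds VACUOUSLY (`cruxWithoutIsReducedAntecedent_holds`,
    `cruxWithoutLFTAntecedent_holds`): "any proof must feed the antecedent reduced finite-type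
    `k̄`-schemes" — for `X` over perfect `k` that is `X_{k̄}`, reduced BECAUSE `k` is perfect (the
    one place perfectness enters);
  - consequent side: `cruxWithoutIsReducedConsequent_iff_antecedent_fails`,
    `cruxWithoutLFTConsequent_iff_antecedent_fails` (the mutated crux ↔ `∀ p prime, ¬ Antecedent p`
    — i.e. FALSE as soon as resolution holds over the algebraically closed fields of one
    characteristic; witnesses `Spec 𝔽_p[ε]`, `Spec 𝔽_p[X]⁺`);
    `cruxWithoutPerfectField_iff` (= `C ∧ DescentPerfectToAll`: the two shared descent cruxes are
    exactly the factorisation "k̄ ⇒ all fields" through perfect fields);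
    `cruxWithPerfectAntecedent_trivial` (replace `IsAlgClosed` by `PerfectField` in the antecedent
    ⇒ tautology: ALGEBRAIC CLOSEDNESS IS THE WHOLE CONTENT); `cruxWithoutPrime_iff` (`p.Prime` is
    decoration modulo `Hironaka1964`).
  - `QuasiCompact f` / `IsSeparated f` in the consequent: NOT attacked successfully — no reduced
    locally-finite-type scheme over a field WITHOUT a resolution is known in any generality, so no
    `_false_without_` is available; informally both look removable GIVEN a Zariski-local (canonical)
    resolution, which is precisely what bare existence does not provide. Recorded as open.
* §B TIGHTNESS / BOUNDARY: `consequent_implies_antecedent` (algebraically closed ⇒ perfect, so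
  `C ↔ ∀ p prime, (Antecedent p ↔ Consequent p)`, `crux_iff_iff`); `zmod_perfect_not_algClosed`
  (the first instance with content is `𝔽̄_p ⇒ 𝔽_p`); `not_isAlgClosed_of_counterexample`.
* §C NATURAL STRENGTHENINGS REFUTED (small models):
  - `strengthening_isRegular_false` — "reduced finite type over perfect ⇒ regular" fails at every
    prime (cusp; transferred from `Theorems.WeightedThesis.Negative`), so `HasResolution` is never
    witnessed by the identity in general;
  - `not_isBirational_comp_galoisField_two` / `not_isResolution_comp_galoisField_two` — THE DEGREE
    OBSTRUCTION in its smallest instance: no `Y → Spec 𝔽_{p²} → Spec 𝔽_p` is birational, so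
    "resolve `X_L` and compose with `X_L → X`" never resolves a geometrically integral `X` when
    `[L:k] > 1` (it is an alteration of degree `[L:k]`). This is WHY the antecedent does not
    transfer: from a resolution `Y → X_{k̄}` one descends to a finite Galois `L/k` and gets
    `Y_L → X_L → X`, an alteration; a resolution of `X` is the same as a `Gal(L/k)`-STABLE
    resolution of `X_L`, and the Galois-symmetrised fibre product `∏_{X_L} σ(Y_L)` is singular.
* §D TARGETS: none this cycle (`payload.stuck_stubs = []`, no line picked).
* §E NEAR-MISSES / WHERE THE GAP SITS (no sorry; the open step is a named hypothesis): the crux follows from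
  `Antecedent p` + (i) geometric reducedness over perfect fields (PROVED, `geomReducedOverPerfect_holds`) + (ii) a limit lemma
  "a resolution of `X_{k̄}` is defined over a finite subextension" (EGA IV₃ §8, standard) +
  (iii) `FiniteDescentOfResolutions` — existence-only descent of `HasResolution` along a
  finite (separable) ground-field extension of a perfect field: THE GAP. (iii) is implied by the
  summit, hence equally irrefutable; printed proofs of (iii) exist only for resolutions produced by
  a Galois-EQUIVARIANT algorithm (Kollár 2007, 3.34.2 / Thm. 3.36(4); BGMW 2011 Remark p. 23;
  Kawanoue–Matsuki 2016 outline). Surfaces: (iii) holds by uniqueness of MINIMAL resolutions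
  (Lipman) — the only dimension where bare existence is known to descend.

## LANDED (proposals `--supports stmt-ResolutionOfSingularities-0550`, kind proof; dry-run ACCEPT)
* p144840 `Theorems/DescentAlgclosedToPerfect/Negative/AntecedentNonVacuity.lean` — §A antecedent
  side (namespace `…Theorems.DescentAlgclosedToPerfect.Negative`: `antecedent_false_without_isReduced`,
  `antecedent_false_without_locallyOfFiniteType`, `not_hasResolution_spec_absoluteIntegralClosure`
  (any field), the two vacuity certificates).
* p145679 `Theorems/DescentAlgclosedToPerfect/Negative/LoadBearing.lean` — §A consequent side, §B,
  §C, irrefutability and minimal-counterexample shape (`descentAlgclosedToPerfect_iff`,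
  `…_without_isReduced_consequent_iff`, `…_without_locallyOfFiniteType_consequent_iff`,
  `…_without_perfectField_consequent_iff`, `…_with_perfectField_antecedent`,
  `…_without_prime_iff`, `not_descentAlgclosedToPerfect_iff`,
  `not_isAlgClosed_of_antecedent_of_not_hasResolution`, `consequent_iff_minimalCase`,
  `not_descentAlgclosedToPerfect_iff_minimalCase`, `not_isBirational_comp_galoisField_two`,
  `not_isResolution_comp_galoisField_two`). Once merged, import them instead of the copies here.

## WHY IT RESISTS (for provers)
Not closable by logic or by any tree fact. Needed: from a BARE resolution of `X_{k̄}` (or `X_L`)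
produce a `Gal`-stable one. Known devices and why each fails here: composing down (degree
obstruction, §C); Galois-symmetrised fibre product / norm of the centre ideal (singular again — the
recorded stall of route Descent); Weil restriction `R_{L/k} Y_L ⊃` preimage of the diagonal
(= the symmetrised fibre product); rigidity (a resolution has no non-trivial automorphism over `X`,
so a Galois-INVARIANT isomorphism class descends — but nothing makes the class invariant without
canonicity); minimal models (only for surfaces). A proof most likely has to import an
equivariant/functorial resolution input, i.e. change the antecedent.
-/

noncomputable section

set_option linter.dupNamespace false

open CategoryTheory CategoryTheory.Limits AlgebraicGeometry TopologicalSpace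
open Literature.AlgebraicGeometry.Resolution
open Summit.ResolutionOfSingularities.ResolutionOfSingularities

namespace Summit.ResolutionOfSingularities.ResolutionOfSingularities.Cruxes.DescentAlgclosedToPerfect.Disproof

/-! ## The two sides of the crux -/

/-- The antecedent at `p`: resolution over ALGEBRAICALLY CLOSED fields of characteristic `p`. -/
def Antecedent (p : ℕ) : Prop :=
  ∀ (k : Type) [Field k] [CharP k p] [IsAlgClosed k] (X : Scheme.{0}) (f : X ⟶ Spec (.of k)),
    IsSeparated f → LocallyOfFiniteType f → QuasiCompact f → IsReduced X → Scheme.HasResolution X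

/-- The consequent at `p`: resolution over PERFECT fields of characteristic `p`. -/
def Consequent (p : ℕ) : Prop :=
  ∀ (k : Type) [Field k] [CharP k p] [PerfectField k] (X : Scheme.{0}) (f : X ⟶ Spec (.of k)),
    IsSeparated f → LocallyOfFiniteType f → QuasiCompact f → IsReduced X → Scheme.HasResolution X

/-- The crux unfolded. -/
theorem crux_iff :
    Theses.RisoStrata.DescentAlgclosedToPerfect ↔ ∀ p : ℕ, p.Prime → Antecedent p → Consequent p :=
  Iff.rfl

/-! ## §B first (used below): tightness — the consequent gives back the antecedent -/

/-- An algebraically closed field is perfect: `Consequent p → Antecedent p`. -/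
theorem consequent_implies_antecedent {p : ℕ} (h : Consequent p) : Antecedent p :=
  fun k _ _ _ X f hs hl hq hr => h k X f hs hl hq hr

/-- So the crux says the two statements are EQUIVALENT prime by prime. -/
theorem crux_iff_iff :
    Theses.RisoStrata.DescentAlgclosedToPerfect ↔ ∀ p : ℕ, p.Prime → (Antecedent p ↔ Consequent p) :=
  ⟨fun h p hp => ⟨h p hp, consequent_implies_antecedent⟩, fun h p hp => (h p hp).mp⟩

/-- The field classes differ: `𝔽_p` is perfect and not algebraically closed — the first instance
of the crux with content is descent from `𝔽̄_p` to `𝔽_p`. -/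
theorem zmod_perfect_not_algClosed (p : ℕ) [Fact p.Prime] :
    PerfectField (ZMod p) ∧ ¬ IsAlgClosed (ZMod p) :=
  ⟨inferInstance, fun h => by
    haveI := h
    haveI : Infinite (ZMod p) := IsAlgClosed.instInfinite
    exact not_finite (ZMod p)⟩

/-- Once the antecedent holds, the ground field of a counterexample to the consequent is NOT
algebraically closed. -/
theorem not_isAlgClosed_of_counterexample {p : ℕ} (hA : Antecedent p) (k : Type) [Field k]
    [CharP k p] (X : Scheme.{0}) (f : X ⟶ Spec (.of k)) [IsSeparated f] [LocallyOfFiniteType f]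
    [QuasiCompact f] [IsReduced X] (hX : ¬ Scheme.HasResolution X) : ¬ IsAlgClosed k := fun halg => by
  haveI := halg
  exact hX (hA k X f ‹_› ‹_› ‹_› ‹_›)

/-! ## Irrefutability certificates -/

/-- `S → C`. -/
theorem crux_of_summit (h : _root_.ResolutionOfSingularities) :
    Theses.RisoStrata.DescentAlgclosedToPerfect :=
  fun p hp _ k _ _ _ X f hs hl hq hr => (_root_.ResolutionOfSingularities_iff.mp h) p hp k X f hs hl hq hr

/-- `¬ C → ¬ S`: refuting this crux refutes the summit. -/
theorem not_summit_of_not_crux (h : ¬ Theses.RisoStrata.DescentAlgclosedToPerfect) :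
    ¬ _root_.ResolutionOfSingularities := fun hs => h (crux_of_summit hs)

/-- `¬ C ↔ ∃ p prime, Antecedent p ∧ ¬ Consequent p` — unfalsifiable by instances. -/
theorem not_crux_iff :
    ¬ Theses.RisoStrata.DescentAlgclosedToPerfect ↔ ∃ p : ℕ, p.Prime ∧ Antecedent p ∧ ¬ Consequent p := by
  rw [crux_iff]; push Not; rfl

/-- The consequent at one prime, modulo `CossartPiltant2019`, is its case of INTEGRAL CLOSED
subschemes of `ℙⁿ_k` of dimension `> 3` (components glue; Chow; projective closure; CP2019). -/
theorem consequent_iff_minimalCase (hCP : CossartPiltant2019.{0}) (p : ℕ) :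
    Consequent p ↔ ∀ (k : Type) [Field k] [CharP k p] [PerfectField k] (n : ℕ) (X : Scheme.{0})
        (ι : X ⟶ (Literature.AlgebraicGeometry.Motives.projectiveSpace n k).left),
        IsClosedImmersion ι → IsIntegral X → ¬ topologicalKrullDim X ≤ 3 →
          Scheme.HasResolution X := by
  have key : ∀ (k : Type) [Field k] (n : ℕ) (X : Scheme.{0})
      (ι : X ⟶ (Literature.AlgebraicGeometry.Motives.projectiveSpace n k).left),
      IsClosedImmersion ι → IsIntegral X →
        IsSeparated (ι ≫ (Literature.AlgebraicGeometry.Motives.projectiveSpace n k).hom) ∧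
        LocallyOfFiniteType (ι ≫ (Literature.AlgebraicGeometry.Motives.projectiveSpace n k).hom) ∧
        QuasiCompact (ι ≫ (Literature.AlgebraicGeometry.Motives.projectiveSpace n k).hom) ∧
        IsReduced X := by
    intro k _ n X ι hι hint
    haveI := hι
    haveI := hint
    haveI : IsProper (Literature.AlgebraicGeometry.Motives.projectiveSpace n k).hom :=
      Literature.AlgebraicGeometry.Motives.isProper_projectiveSpace n k
    exact ⟨inferInstance, inferInstance, inferInstance, inferInstance⟩
  constructor
  · intro h k _ _ _ n X ι hι hint _
    obtain ⟨h1, h2, h3, h4⟩ := key k n X ι hι hint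
    exact h k X _ h1 h2 h3 h4
  · intro h k _ _ _ X f hsep hft hqc hred
    refine hasResolution_of_forall_closeds X f fun Z hZ => ?_
    obtain ⟨n, X', π, ι, hint', hι, hπ, -, -, U, hU, hU', hiso⟩ :=
      ChowLemmaIntegral_holds k _ ((Scheme.IdealSheafData.vanishingIdeal Z).subschemeι ≫ f)
        inferInstance inferInstance inferInstance hZ
    haveI := hπ
    haveI := hι
    haveI := hint'
    refine Scheme.HasResolution.of_isBirational π ⟨U, hU, hU', hiso⟩ ?_
    obtain ⟨Xbar, j, c, hXbar, hj, hc, -, hdimbar⟩ := exists_projectiveClosure ι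
    haveI := hj
    refine Scheme.HasResolution.of_isOpenImmersion j ?_
    by_cases hdim : topologicalKrullDim Xbar ≤ 3
    · obtain ⟨h1, h2, h3, h4⟩ := key k n Xbar c hc hXbar
      exact hCP k Xbar _ h1 h2 h3 h4 hdim
    · exact h k n Xbar c hc hXbar hdim

/-- SHAPE OF A REFUTATION (modulo `CossartPiltant2019`): a prime `p` with resolution over every
algebraically closed field of characteristic `p`, together with an integral closed subscheme of
some `ℙⁿ_k`, of dimension `≥ 4`, over a perfect NOT algebraically closed field `k` of
characteristic `p`, admitting no resolution. -/
theorem not_crux_iff_minimalCase (hCP : CossartPiltant2019.{0}) :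
    ¬ Theses.RisoStrata.DescentAlgclosedToPerfect ↔ ∃ p : ℕ, p.Prime ∧ Antecedent p ∧
      ∃ (k : Type) (_ : Field k) (_ : CharP k p) (_ : PerfectField k), ¬ IsAlgClosed k ∧
        ∃ (n : ℕ) (X : Scheme.{0})
          (ι : X ⟶ (Literature.AlgebraicGeometry.Motives.projectiveSpace n k).left),
          IsClosedImmersion ι ∧ IsIntegral X ∧ ¬ topologicalKrullDim X ≤ 3 ∧
            ¬ Scheme.HasResolution X := by
  constructor
  · intro hnot
    obtain ⟨p, hp, hA, hC⟩ := not_crux_iff.mp hnot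
    refine ⟨p, hp, hA, ?_⟩
    by_contra hcon
    refine hC ((consequent_iff_minimalCase hCP p).mpr fun k _ _ _ n X ι hι hint hdim => ?_)
    by_contra hX
    haveI := hι
    haveI := hint
    haveI : IsProper (Literature.AlgebraicGeometry.Motives.projectiveSpace n k).hom :=
      Literature.AlgebraicGeometry.Motives.isProper_projectiveSpace n k
    refine hcon ⟨k, ‹Field k›, ‹CharP k p›, ‹PerfectField k›,
      not_isAlgClosed_of_counterexample hA k X
        (ι ≫ (Literature.AlgebraicGeometry.Motives.projectiveSpace n k).hom) hX, ?_⟩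
    exact ⟨n, X, ι, hι, hint, hdim, hX⟩
  · rintro ⟨p, hp, hA, k, _, _, _, -, hrest⟩ hC
    obtain ⟨n, X, ι, hι, hint, hdim, hX⟩ := hrest
    exact hX ((consequent_iff_minimalCase hCP p).mp (hC p hp hA) k n X ι hι hint hdim)

/-! ## §A Load-bearing analysis — antecedent side (non-vacuity) -/

/-- The antecedent with `IsReduced X` dropped. -/
def AntecedentWithoutIsReduced (p : ℕ) : Prop :=
  ∀ (k : Type) [Field k] [CharP k p] [IsAlgClosed k] (X : Scheme.{0}) (f : X ⟶ Spec (.of k)),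
    IsSeparated f → LocallyOfFiniteType f → QuasiCompact f → Scheme.HasResolution X

/-- The antecedent with `LocallyOfFiniteType f` dropped. -/
def AntecedentWithoutLFT (p : ℕ) : Prop :=
  ∀ (k : Type) [Field k] [CharP k p] [IsAlgClosed k] (X : Scheme.{0}) (f : X ⟶ Spec (.of k)),
    IsSeparated f → QuasiCompact f → IsReduced X → Scheme.HasResolution X

/-- The crux with `IsReduced` dropped from the antecedent. -/
def DescentAlgclosedToPerfectWithoutIsReducedAntecedent : Prop :=
  ∀ p : ℕ, p.Prime → AntecedentWithoutIsReduced p → Consequent p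

/-- The crux with `LocallyOfFiniteType` dropped from the antecedent. -/
def DescentAlgclosedToPerfectWithoutLFTAntecedent : Prop :=
  ∀ p : ℕ, p.Prime → AntecedentWithoutLFT p → Consequent p

/-- **`AntecedentWithoutIsReduced p` is false at every prime** (witness `Spec 𝔽̄_p[ε]`). -/
theorem antecedent_false_without_isReduced (p : ℕ) [Fact p.Prime] :
    ¬ AntecedentWithoutIsReduced p := by
  intro h
  let K : Type := AlgebraicClosure (ZMod p)
  haveI : Module.Finite K (DualNumber K) := inferInstanceAs (Module.Finite K (K × K))
  let f : Spec (.of (DualNumber K)) ⟶ Spec (.of K) :=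
    Spec.map (CommRingCat.ofHom (algebraMap K (DualNumber K)))
  haveI : LocallyOfFiniteType f :=
    (HasRingHomProperty.Spec_iff (P := @LocallyOfFiniteType)).mpr
      (RingHom.finiteType_algebraMap.mpr inferInstance)
  exact not_hasResolution_spec_dualNumber K
    (h K (Spec (.of (DualNumber K))) f inferInstance inferInstance inferInstance)

/-- Hence that mutation of the crux holds VACUOUSLY (true for the wrong reason). -/
theorem cruxWithoutIsReducedAntecedent_holds : DescentAlgclosedToPerfectWithoutIsReducedAntecedent := by
  intro p hp hA
  haveI : Fact p.Prime := ⟨hp⟩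
  exact absurd hA (antecedent_false_without_isReduced p)

section AbsoluteIntegralClosure

open Polynomial

variable (F : Type) [Field F]

/-- `F[X] → F[X]⁺` is injective, for any field `F`. -/
theorem aic_algebraMap_injective :
    Function.Injective (algebraMap F[X] ↥(integralClosure F[X] (AlgebraicClosure (RatFunc F)))) := by
  have h : Function.Injective (algebraMap F[X] (AlgebraicClosure (RatFunc F))) := by
    rw [IsScalarTower.algebraMap_eq F[X] (RatFunc F) (AlgebraicClosure (RatFunc F))]
    exact (algebraMap (RatFunc F) _).injective.comp (RatFunc.algebraMap_injective F)
  intro a b hab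
  apply h
  have := congrArg
    (fun x : ↥(integralClosure F[X] (AlgebraicClosure (RatFunc F))) =>
      (x : AlgebraicClosure (RatFunc F))) hab
  simpa using this

/-- Every element of `F[X]⁺` is a square. -/
theorem aic_exists_sq_eq (a : ↥(integralClosure F[X] (AlgebraicClosure (RatFunc F)))) :
    ∃ b : ↥(integralClosure F[X] (AlgebraicClosure (RatFunc F))), b ^ 2 = a := by
  obtain ⟨z, hz⟩ := IsAlgClosed.exists_pow_nat_eq (a : AlgebraicClosure (RatFunc F)) two_pos
  have hzint : IsIntegral F[X] z := IsIntegral.of_pow two_pos (by rw [hz]; exact a.2)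
  exact ⟨⟨z, hzint⟩, Subtype.ext hz⟩

/-- Every non-zero `f ∈ F[X]⁺` avoids some non-zero prime (lying over; Stacks 00FZ). -/
theorem aic_exists_prime_not_mem
    (f : ↥(integralClosure F[X] (AlgebraicClosure (RatFunc F)))) (hf : f ≠ 0) :
    ∃ Q : Ideal ↥(integralClosure F[X] (AlgebraicClosure (RatFunc F))),
      Q.IsPrime ∧ Q ≠ ⊥ ∧ f ∉ Q := by
  have hinj := aic_algebraMap_injective F
  obtain ⟨P, hPm, hPf⟩ := (integralClosure.isIntegral f : IsIntegral F[X] f)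
  obtain ⟨P', hP, hXP'⟩ := P.exists_eq_pow_rootMultiplicity_mul_and_not_dvd hPm.ne_zero 0
  simp only [map_zero, sub_zero] at hP hXP'
  set c := P'.coeff 0 with hc_def
  have hc : c ≠ 0 := fun h0 => hXP' (Polynomial.X_dvd_iff.mpr h0)
  have hP'f : Polynomial.aeval f P' = 0 := by
    have h1 : Polynomial.aeval f P = 0 := hPf
    rw [hP, map_mul, map_pow, Polynomial.aeval_X] at h1
    exact (mul_eq_zero.mp h1).resolve_left (pow_ne_zero _ hf)
  have hrel : algebraMap F[X] _ c = -(Polynomial.aeval f P'.divX * f) := by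
    have h1 := hP'f
    rw [← Polynomial.divX_mul_X_add P', map_add, map_mul, Polynomial.aeval_X,
      Polynomial.aeval_C] at h1
    linear_combination h1
  have hdeg : (c * X + 1 : F[X]).natDegree = c.natDegree + 1 := by
    rw [Polynomial.natDegree_add_eq_left_of_natDegree_lt] <;>
      rw [Polynomial.natDegree_mul_X hc]
    simp
  have hne : (c * X + 1 : F[X]) ≠ 0 := by
    intro h0; rw [h0] at hdeg; simp at hdeg
  have hnu : ¬ IsUnit (c * X + 1 : F[X]) := by
    intro hu
    have := Polynomial.natDegree_eq_zero_of_isUnit hu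
    omega
  obtain ⟨π, hπirr, hπdvd⟩ := WfDvdMonoid.exists_irreducible_factor hnu hne
  have hπc : ¬ π ∣ c := by
    intro hdc
    apply hπirr.not_isUnit
    have : π ∣ (c * X + 1) - c * X := dvd_sub hπdvd (dvd_mul_of_dvd_left hdc _)
    exact isUnit_of_dvd_one (by simpa using this)
  let 𝔭 : Ideal F[X] := Ideal.span {π}
  haveI h𝔭 : 𝔭.IsPrime := (Ideal.span_singleton_prime hπirr.ne_zero).mpr hπirr.prime
  obtain ⟨Q, -, hQ, hQcomap⟩ := Ideal.exists_ideal_over_prime_of_isIntegral 𝔭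
    (⊥ : Ideal ↥(integralClosure F[X] (AlgebraicClosure (RatFunc F))))
    (by
      intro a ha
      have ha0 : algebraMap F[X]
          ↥(integralClosure F[X] (AlgebraicClosure (RatFunc F))) a = 0 :=
        Ideal.mem_bot.mp (Ideal.mem_comap.mp ha)
      have : a = 0 := hinj (by rw [ha0, map_zero])
      rw [this]; exact 𝔭.zero_mem)
  refine ⟨Q, hQ, ?_, ?_⟩
  · rintro rfl
    have hπmem : π ∈ (⊥ : Ideal ↥(integralClosure F[X]
        (AlgebraicClosure (RatFunc F)))).comap (algebraMap F[X] _) := by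
      rw [hQcomap]; exact Ideal.mem_span_singleton_self π
    have hπ0 : algebraMap F[X]
        ↥(integralClosure F[X] (AlgebraicClosure (RatFunc F))) π = 0 :=
      Ideal.mem_bot.mp (Ideal.mem_comap.mp hπmem)
    exact hπirr.ne_zero (hinj (by rw [hπ0, map_zero]))
  · intro hfQ
    have h1 : algebraMap F[X] _ c ∈ Q := by
      rw [hrel]; exact Q.neg_mem (Q.mul_mem_left _ hfQ)
    have h2 : c ∈ 𝔭 := by rw [← hQcomap]; exact h1
    exact hπc (Ideal.mem_span_singleton.mp h2)

/-- **`Spec F[X]⁺` has no resolution of singularities**, for any field `F`. -/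
theorem not_hasResolution_spec_aic :
    ¬ Scheme.HasResolution (Spec (.of ↥(integralClosure F[X] (AlgebraicClosure (RatFunc F))))) :=
  not_hasResolution_spec_of_forall_exists_pow_eq _ le_rfl (aic_exists_sq_eq F)
    (aic_exists_prime_not_mem F)

end AbsoluteIntegralClosure

/-- **`AntecedentWithoutLFT p` is false at every prime** (witness `Spec 𝔽̄_p[X]⁺ → Spec 𝔽̄_p`). -/
theorem antecedent_false_without_locallyOfFiniteType (p : ℕ) [Fact p.Prime] :
    ¬ AntecedentWithoutLFT p := by
  intro h
  let K : Type := AlgebraicClosure (ZMod p)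
  let f : Spec (.of ↥(integralClosure (Polynomial K) (AlgebraicClosure (RatFunc K)))) ⟶
      Spec (.of K) :=
    Spec.map (CommRingCat.ofHom ((algebraMap (Polynomial K)
      ↥(integralClosure (Polynomial K) (AlgebraicClosure (RatFunc K)))).comp Polynomial.C))
  exact not_hasResolution_spec_aic K (h K _ f inferInstance inferInstance inferInstance)

/-- Hence that mutation of the crux holds VACUOUSLY. -/
theorem cruxWithoutLFTAntecedent_holds : DescentAlgclosedToPerfectWithoutLFTAntecedent := by
  intro p hp hA
  haveI : Fact p.Prime := ⟨hp⟩
  exact absurd hA (antecedent_false_without_locallyOfFiniteType p)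

/-! ## §A Load-bearing analysis — consequent side -/

/-- The consequent with `IsReduced X` dropped. -/
def ConsequentWithoutIsReduced (p : ℕ) : Prop :=
  ∀ (k : Type) [Field k] [CharP k p] [PerfectField k] (X : Scheme.{0}) (f : X ⟶ Spec (.of k)),
    IsSeparated f → LocallyOfFiniteType f → QuasiCompact f → Scheme.HasResolution X

/-- The consequent with `LocallyOfFiniteType f` dropped. -/
def ConsequentWithoutLFT (p : ℕ) : Prop :=
  ∀ (k : Type) [Field k] [CharP k p] [PerfectField k] (X : Scheme.{0}) (f : X ⟶ Spec (.of k)),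
    IsSeparated f → QuasiCompact f → IsReduced X → Scheme.HasResolution X

/-- The crux with `IsReduced` dropped from the consequent. -/
def DescentAlgclosedToPerfectWithoutIsReducedConsequent : Prop :=
  ∀ p : ℕ, p.Prime → Antecedent p → ConsequentWithoutIsReduced p

/-- The crux with `LocallyOfFiniteType` dropped from the consequent. -/
def DescentAlgclosedToPerfectWithoutLFTConsequent : Prop :=
  ∀ p : ℕ, p.Prime → Antecedent p → ConsequentWithoutLFT p

/-- The crux with `[PerfectField k]` dropped from the consequent (= all fields of char `p`). -/
def DescentAlgclosedToPerfectWithoutPerfectField : Prop :=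
  ∀ p : ℕ, p.Prime → Antecedent p → ResolutionInChar.{0} p

/-- The crux with `p.Prime` dropped. -/
def DescentAlgclosedToPerfectWithoutPrime : Prop :=
  ∀ p : ℕ, Antecedent p → Consequent p

/-- `ConsequentWithoutIsReduced p` is false at every prime (`Spec 𝔽_p[ε]`; landed in
`Theorems.WeightedThesis.Negative`). -/
theorem consequent_false_without_isReduced (p : ℕ) [Fact p.Prime] : ¬ ConsequentWithoutIsReduced p :=
  Theorems.WeightedThesis.Negative.weightedThesis_false_without_isReduced_at p

/-- `ConsequentWithoutLFT p` is false at every prime (`Spec 𝔽_p[X]⁺`; landed ibid.). -/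
theorem consequent_false_without_locallyOfFiniteType (p : ℕ) [Fact p.Prime] : ¬ ConsequentWithoutLFT p :=
  Theorems.WeightedThesis.Negative.weightedThesis_false_without_locallyOfFiniteType_at p

/-- **MUTATION: with `IsReduced` dropped from the consequent the crux is equivalent to the failure
of the antecedent at EVERY prime** — `IsReduced` on the right is load-bearing as soon as
resolution holds over the algebraically closed fields of one characteristic. (An unconditional
`_false_without_` is not available: it would require PROVING `Antecedent p` for some `p`.) -/
theorem cruxWithoutIsReducedConsequent_iff_antecedent_fails :
    DescentAlgclosedToPerfectWithoutIsReducedConsequent ↔ ∀ p : ℕ, p.Prime → ¬ Antecedent p :=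
  ⟨fun h p hp hA => by haveI : Fact p.Prime := ⟨hp⟩; exact consequent_false_without_isReduced p (h p hp hA),
    fun h p hp hA => absurd hA (h p hp)⟩

/-- **MUTATION: same for `LocallyOfFiniteType` on the right.** -/
theorem cruxWithoutLFTConsequent_iff_antecedent_fails :
    DescentAlgclosedToPerfectWithoutLFTConsequent ↔ ∀ p : ℕ, p.Prime → ¬ Antecedent p :=
  ⟨fun h p hp hA => by
      haveI : Fact p.Prime := ⟨hp⟩
      exact consequent_false_without_locallyOfFiniteType p (h p hp hA),
    fun h p hp hA => absurd hA (h p hp)⟩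

/-- **MUTATION: with `[PerfectField k]` dropped from the consequent the crux is
`C ∧ DescentPerfectToAll`** — the two shared descent cruxes are EXACTLY the factorisation of
"algebraically closed ⇒ all fields of char `p`" through perfect fields. -/
theorem cruxWithoutPerfectField_iff :
    DescentAlgclosedToPerfectWithoutPerfectField ↔
      Theses.RisoStrata.DescentAlgclosedToPerfect ∧ Theses.RisoStrata.DescentPerfectToAll :=
  ⟨fun h => ⟨fun p hp hA k _ _ _ X f hs hl hq hr => h p hp hA k X f hs hl hq hr,
      fun p hp hP => h p hp (consequent_implies_antecedent fun k _ _ _ X f hs hl hq hr => hP k X f hs hl hq hr)⟩,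
    fun ⟨hC, hD⟩ p hp hA => hD p hp (hC p hp hA)⟩

/-- **MUTATION: replacing `[IsAlgClosed k]` by `[PerfectField k]` in the ANTECEDENT makes the crux
a tautology** — algebraic closedness in the antecedent is THE load-bearing restriction. -/
theorem cruxWithPerfectAntecedent_trivial : ∀ p : ℕ, p.Prime → Consequent p → Consequent p :=
  fun _ _ h => h

/-- **MUTATION: `p.Prime` dropped** adds only the `p = 0` clause (no field has characteristic `1`
or a composite characteristic). -/
theorem cruxWithoutPrime_iff :
    DescentAlgclosedToPerfectWithoutPrime ↔
      Theses.RisoStrata.DescentAlgclosedToPerfect ∧ (Antecedent 0 → Consequent 0) := by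
  refine ⟨fun h => ⟨fun p _ => h p, h 0⟩, fun ⟨h, h0⟩ p hA k _ _ _ X f hs hl hq hr => ?_⟩
  rcases CharP.char_is_prime_or_zero k p with hp | rfl
  · exact h p hp hA k X f hs hl hq hr
  · exact h0 hA k X f hs hl hq hr

/-- … and the `p = 0` clause is Hironaka's theorem (named fact, weak form). -/
theorem cruxAtZero_of_hironaka (h : Hironaka1964.{0}) : Antecedent 0 → Consequent 0 :=
  fun _ k _ _ _ X f hs hl hq hr => h k X f hs hl hq hr

/-! ## §C Natural strengthenings refuted (small models) -/

/-- STRENGTHENING refuted at every prime: "reduced separated finite type over a perfect field ⇒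
regular" fails (cusp `Spec 𝔽_p[T²,T³]`; landed in `Theorems.WeightedThesis.Negative`) — the
consequent is never witnessed by the identity in general. -/
theorem strengthening_isRegular_false (p : ℕ) [Fact p.Prime] :
    ¬ ∀ (k : Type) [Field k] [CharP k p] [PerfectField k] (Y : Scheme.{0})
        (f : Y ⟶ Spec (.of k)), IsSeparated f → LocallyOfFiniteType f → QuasiCompact f →
          IsReduced Y → Scheme.IsRegular Y :=
  Theorems.WeightedThesis.Negative.weightedThesis_strengthening_isRegular_false p

/-- **THE DEGREE OBSTRUCTION, smallest instance.** No morphism `Y → Spec 𝔽_{p²}` becomes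
birational onto `Spec 𝔽_p` after composing with `Spec 𝔽_{p²} → Spec 𝔽_p` (the only dense open of
`Spec 𝔽_p` is everything, so birational = isomorphism; then `Spec 𝔽_p ≅ Y → Spec 𝔽_{p²}` is a
ring map `𝔽_{p²} → 𝔽_p`, injective — impossible, `p² > p`). So "resolve `X_L`, compose with
`X_L → X`" is an alteration of degree `[L:k]`, never a resolution of a geometrically integral `X`
when `[L:k] > 1`. -/
theorem not_isBirational_comp_galoisField_two (p : ℕ) [Fact p.Prime] (Y : Scheme.{0})
    (g : Y ⟶ Spec (.of (GaloisField p 2))) :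
    ¬ IsBirational (g ≫ Spec.map (CommRingCat.ofHom (algebraMap (ZMod p) (GaloisField p 2)))) := by
  rintro ⟨U, hUd, -, hiso⟩
  set π := g ≫ Spec.map (CommRingCat.ofHom (algebraMap (ZMod p) (GaloisField p 2))) with hπ
  have hU : U = ⊤ := by
    obtain ⟨x, hx⟩ := hUd.nonempty
    ext y
    simp only [Opens.coe_top, Set.mem_univ, iff_true]
    rwa [Subsingleton.elim y x]
  subst hU
  haveI : IsIso π := by
    have := (IsZariskiLocalAtTarget.iff_of_iSup_eq_top (P := MorphismProperty.isomorphisms Scheme)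
      (f := π) (fun _ : Unit => (⊤ : (Spec (.of (ZMod p))).Opens)) (by simp)).mpr
      fun _ => (MorphismProperty.isomorphisms.iff _).mpr hiso
    exact (MorphismProperty.isomorphisms.iff _).mp this
  let φ : GaloisField p 2 →+* ZMod p := (Spec.preimage (inv π ≫ g)).hom
  have h1 := Nat.card_le_card_of_injective φ φ.injective
  rw [GaloisField.card p 2 two_ne_zero, Nat.card_zmod] at h1
  have hp := (Fact.out : p.Prime).two_le
  nlinarith

/-- Hence no `Y → Spec 𝔽_{p²} → Spec 𝔽_p` is a resolution of `Spec 𝔽_p` (which is its own). -/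
theorem not_isResolution_comp_galoisField_two (p : ℕ) [Fact p.Prime] (Y : Scheme.{0})
    (g : Y ⟶ Spec (.of (GaloisField p 2))) :
    ¬ IsResolution (g ≫ Spec.map (CommRingCat.ofHom (algebraMap (ZMod p) (GaloisField p 2)))) :=
  fun h => not_isBirational_comp_galoisField_two p Y g h.isBirational

-- Targets: none (payload.stuck_stubs = [], no line picked in cycle 1).

/-! ## §E Where the gap sits — the crux factors through ONE unproved step

No `sorry`: the three steps are stated as `def … : Prop`; (i) is PROVED
(`geomReducedOverPerfect_holds`); the factorisation `crux_of_steps` /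
`crux_of_limit_and_finiteDescent` is proved; modulo (ii) alone the crux is EQUIVALENT to
"antecedent ⇒ (iii)" (`crux_iff_finiteDescent`); and (iii) is implied by the summit (so it is as
irrefutable as the crux). (ii) is standard mathematics (EGA IV₃ §8) not yet in the tree in this
form; (iii) is the open existence-only descent. -/

/-- Base change `X_K` of `f : X ⟶ Spec k` along a field extension `k → K`. -/
abbrev baseChange {k : Type} [Field k] {X : Scheme.{0}} (f : X ⟶ Spec (.of k)) (K : Type) [Field K]
    [Algebra k K] : Scheme.{0} :=
  pullback f (Spec.map (CommRingCat.ofHom (algebraMap k K)))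

/-- Its structure morphism `X_K ⟶ Spec K`. -/
abbrev baseChangeHom {k : Type} [Field k] {X : Scheme.{0}} (f : X ⟶ Spec (.of k)) (K : Type) [Field K]
    [Algebra k K] : baseChange f K ⟶ Spec (.of K) :=
  pullback.snd f (Spec.map (CommRingCat.ofHom (algebraMap k K)))

/-- (i) Over a PERFECT field reducedness survives every ground-field extension (EGA IV₂ 4.6.1,
Stacks 030V: reduced over perfect ⇒ geometrically reduced). PROVED below
(`geomReducedOverPerfect_holds`, from the tree's `geometricallyReduced_SpecMap_of_perfectField` and
Mathlib's "geometrically reduced flat base change of a reduced locally Noetherian scheme is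
reduced"); the one place where perfectness of `k` is used — it makes `X_{k̄}` an admissible input
of the antecedent (cf. §A: the antecedent without `IsReduced` is false). -/
def GeomReducedOverPerfect (p : ℕ) : Prop :=
  ∀ (k : Type) [Field k] [CharP k p] [PerfectField k] (K : Type) [Field K] [Algebra k K]
    (X : Scheme.{0}) (f : X ⟶ Spec (.of k)), LocallyOfFiniteType f → IsReduced X →
      IsReduced (baseChange f K)

/-- **Step (i) holds** (for locally finite type `X`; `p` plays no role). -/
theorem geomReducedOverPerfect_holds (p : ℕ) : GeomReducedOverPerfect p := by
  intro k _ _ _ K _ _ X f hl hr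
  haveI : GeometricallyReduced (Spec.map (CommRingCat.ofHom (algebraMap k K))) :=
    Literature.AlgebraicGeometry.Motives.geometricallyReduced_SpecMap_of_perfectField k K
  haveI : Flat (Spec.map (CommRingCat.ofHom (algebraMap k K))) := by
    rw [HasRingHomProperty.Spec_iff (P := @Flat)]
    show (algebraMap k K).Flat
    rw [RingHom.flat_algebraMap_iff]
    infer_instance
  haveI : IsLocallyNoetherian X := LocallyOfFiniteType.isLocallyNoetherian f
  infer_instance

/-- (ii) LIMIT LEMMA: a resolution of `X_{k̄}` is defined, as a resolution, over a finite
subextension `L/k` (EGA IV₃ 8.8.2, 8.10.5 for the proper morphism; flat descent of regularity,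
Matsumura 23.7, for `Y_L`; the dense open of the isomorphism descends after enlarging `L`). TRUE,
standard; in the tree only the purely inseparable analogue is formalised
(`Theorems.WildQuotientsGaloisQuotientAlterationPerfectDescent`). -/
def LimitDescentOfResolutions (p : ℕ) : Prop :=
  ∀ (k : Type) [Field k] [CharP k p] [PerfectField k] (X : Scheme.{0}) (f : X ⟶ Spec (.of k)),
    IsSeparated f → LocallyOfFiniteType f → QuasiCompact f → IsReduced X →
      Scheme.HasResolution (baseChange f (AlgebraicClosure k)) →
        ∃ L : IntermediateField k (AlgebraicClosure k), FiniteDimensional k L ∧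
          Scheme.HasResolution (baseChange f L)

/-- (iii) **THE GAP** — existence-only descent of resolutions along a FINITE extension `L/k` of a
perfect ground field (automatically separable; WLOG Galois): `HasResolution X_L → HasResolution X`.
Equivalent to producing a `Gal(L/k)`-STABLE resolution of `X_L` from a bare one. In print only for
resolutions output by a Galois-equivariant ALGORITHM (Kollár 2007, 3.34.2 / Thm. 3.36(4); BGMW
2011, Remark p. 23); for surfaces by uniqueness of the minimal resolution (Lipman 1978). Open in
general; implied by the summit (`finiteDescent_of_summit`), so not refutable either. -/
def FiniteDescentOfResolutions (p : ℕ) : Prop :=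
  ∀ (k : Type) [Field k] [CharP k p] [PerfectField k] (L : Type) [Field L] [Algebra k L]
    [FiniteDimensional k L] (X : Scheme.{0}) (f : X ⟶ Spec (.of k)),
    IsSeparated f → LocallyOfFiniteType f → QuasiCompact f → IsReduced X →
      Scheme.HasResolution (baseChange f L) → Scheme.HasResolution X

/-- **The crux factors through the gap**: (i) + (ii) + (iii) at every prime ⇒
`DescentAlgclosedToPerfect` (apply the antecedent to `X_{k̄} → Spec k̄`, which is separated, of
finite type — base change — and reduced by (i); come down to a finite level by (ii); descend by
(iii)). Since (i), (ii) are theorems of the literature, THE CONTENT OF THE CRUX IS (iii). -/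
theorem crux_of_steps (h1 : ∀ p : ℕ, p.Prime → GeomReducedOverPerfect p)
    (h2 : ∀ p : ℕ, p.Prime → LimitDescentOfResolutions p)
    (h3 : ∀ p : ℕ, p.Prime → FiniteDescentOfResolutions p) :
    Theses.RisoStrata.DescentAlgclosedToPerfect := by
  intro p hp hA k _ _ _ X f hs hl hq hr
  haveI : Fact p.Prime := ⟨hp⟩
  let K : Type := AlgebraicClosure k
  haveI : IsReduced (baseChange f K) := h1 p hp k K X f hl hr
  have hK : Scheme.HasResolution (baseChange f K) :=
    hA K (baseChange f K) (baseChangeHom f K) inferInstance inferInstance inferInstance inferInstance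
  obtain ⟨L, hLfin, hL⟩ := h2 p hp k X f hs hl hq hr hK
  haveI := hLfin
  exact h3 p hp k L X f hs hl hq hr hL

/-- The gap step is implied by the summit (hence irrefutable, like the crux). -/
theorem finiteDescent_of_summit (h : _root_.ResolutionOfSingularities) (p : ℕ) (hp : p.Prime) :
    FiniteDescentOfResolutions p :=
  fun k _ _ _ _ _ _ _ X f hs hl hq hr _ => (_root_.ResolutionOfSingularities_iff.mp h) p hp k X f hs hl hq hr

/-- Conversely, given the antecedent, the crux yields the gap step for free (its consequent
resolves `X` outright). -/
theorem finiteDescent_of_crux (hC : Theses.RisoStrata.DescentAlgclosedToPerfect) (p : ℕ)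
    (hp : p.Prime) (hA : Antecedent p) : FiniteDescentOfResolutions p :=
  fun k _ _ _ _ _ _ _ X f hs hl hq hr _ => hC p hp hA k X f hs hl hq hr

/-- **MODULO THE LIMIT LEMMA (ii) ALONE, THE CRUX IS EQUIVALENT TO "antecedent ⇒ finite descent
of resolutions", prime by prime** (step (i) being proved): the mathematical content of
`DescentAlgclosedToPerfect` is exactly `FiniteDescentOfResolutions`. -/
theorem crux_iff_finiteDescent (h2 : ∀ p : ℕ, p.Prime → LimitDescentOfResolutions p) :
    Theses.RisoStrata.DescentAlgclosedToPerfect ↔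
      ∀ p : ℕ, p.Prime → Antecedent p → FiniteDescentOfResolutions p := by
  refine ⟨fun hC p hp hA => finiteDescent_of_crux hC p hp hA, fun h p hp hA k _ _ _ X f hs hl hq hr => ?_⟩
  haveI : Fact p.Prime := ⟨hp⟩
  let K : Type := AlgebraicClosure k
  haveI : IsReduced (baseChange f K) := geomReducedOverPerfect_holds p k K X f hl hr
  have hK : Scheme.HasResolution (baseChange f K) :=
    hA K (baseChange f K) (baseChangeHom f K) inferInstance inferInstance inferInstance inferInstance
  obtain ⟨L, hLfin, hL⟩ := h2 p hp k X f hs hl hq hr hK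
  haveI := hLfin
  exact h p hp hA k L X f hs hl hq hr hL

/-- The factorisation with step (i) discharged: (ii) + (iii) ⇒ the crux. -/
theorem crux_of_limit_and_finiteDescent (h2 : ∀ p : ℕ, p.Prime → LimitDescentOfResolutions p)
    (h3 : ∀ p : ℕ, p.Prime → FiniteDescentOfResolutions p) :
    Theses.RisoStrata.DescentAlgclosedToPerfect :=
  (crux_iff_finiteDescent h2).mpr fun p hp _ => h3 p hp

end Summit.ResolutionOfSingularities.ResolutionOfSingularities.Cruxes.DescentAlgclosedToPerfect.Disproof

end
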